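import Summits.Ventures.AbcSig.Rows.XTemplateB
import Summits.Ventures.AbcSig.Rows.TemplateBC

/-!
# Venture AbcSig — EXTENDED ROW TEMPLATE for `xⁿ + 2^α yⁿ = C z²`, `α ≥ 7` (FAMILY C1b, the `α ≥ 7` class of RULING H1)

HONEST FRAMING. Fully PROVED template theorem of a COMPUTATION cell (`pub-abcsig`); CONDITIONAL on named hypotheses,
no claim on ABC or any summit. For `A = 1`, `B = 2^α` with `7 ≤ α < n` (the REDUCED 2-exponent class
`Rows.AlphaGe7Reduced n α` of `Rows/Statements.lean`) and odd squarefree `C`, EVERY primitive solution — whatever the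
parity of `y` — has `2⁷ ∣ 2^α yⁿ`, i.e. is in case (v₇) of [BS04, Lemma 2.1/3.2] at the single level `2·C²` (after the
sign change `c ≡ C (mod 4)`; same bookkeeping as `branchBC_v7` of `Rows/TemplateBC.lean`, which needs `y` even because it
serves every `α`). The per-orbit hypothesis is the extended alternative
`o.Eliminated bs04Allowed n ∨ (M.Excludes (2C²) o (famBCge7 C n) ∨ M.ExcludesStd (2C²) o n)` (pattern of
`Rows/XTemplateBC.lean`), with the family predicate `famBCge7 C n` UNIFORM in `α` — so one row serves the whole class
`7 ≤ α ≤ n − 1` of a census cell `Rows.C1bCell C Rows.AlphaGe7Reduced n₀ R` (`Rows/StatementsC1b.lean`).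

* `famBCge7` — the family predicate `A = 1`, `B = 2^α` for some `7 ≤ α < n`, `C`, exponent `n`;
* `xbranchBC_ge7` — the template theorem (level `2C²`, final step `xno_solution_in_case` of `Rows/XTemplateB.lean`).

Reference: [BS04] M. A. Bennett, C. M. Skinner, Canad. J. Math. 56 (2004) 23–54, §§2–4 and Thm. 1.2.
-/

namespace Summit.Ventures.AbcSig

/-- The family predicate of the `α ≥ 7` class: `A = 1`, `B = 2^α` for some `7 ≤ α < n`, the given `C` and exponent `n`
(no condition on `a`, `b`). -/
def famBCge7 (C n : ℕ) (S : FreyDatum) : Prop :=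
  S.A = 1 ∧ (∃ α : ℕ, 7 ≤ α ∧ α < n ∧ S.B = 2 ^ α) ∧ S.C = C ∧ S.n = n

/-- EXTENDED **Branch (v₇) for the whole class `7 ≤ α < n`**: level `2·C²`. For odd squarefree `C`, a prime `n ≥ 7` with
`n ∤ C`, `7 ≤ α < n`, and the cell's hypotheses at level `2C²` (kernel sieve certificate, or a cited exclusion for the
α-uniform family `famBCge7 C n`, or a standing-datum exclusion `ExcludesStd` from a kernel module certificate), there is
no primitive solution of `xⁿ + 2^α yⁿ = C z²` with `xy ≠ ±1`. -/
theorem xbranchBC_ge7 (α C : ℕ) (hsq : Squarefree C) (hCodd : Odd C) (M : NewformModel)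
    (hP : M.BS04Package) {orbs : List OrbitData} (hD : M.DataComplete (2 * C ^ 2) orbs)
    (n : ℕ) (hn : n.Prime) (h7 : 7 ≤ n) (hnC : ¬ n ∣ C) (hα7 : 7 ≤ α) (hαn : α < n)
    (hS : ∀ o ∈ orbs, (∀ e ∈ o.coeffs, e.ell.Prime ∧ e.ell ≠ 2 ∧ ¬ e.ell ∣ 2 * C ^ 2) ∧
      (o.Eliminated bs04Allowed n ∨ (M.Excludes (2 * C ^ 2) o (famBCge7 C n) ∨
        M.ExcludesStd (2 * C ^ 2) o n)))
    (x y z : ℤ) (h1 : x * y ≠ 1) (h2 : x * y ≠ -1) :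
    ¬ IsPrimitiveSolution 1 (2 ^ α) C n x y z := by
  intro hsol
  have hCpos : 0 < C := hCodd.pos
  have hCoddZ : ¬ 2 ∣ (C : ℤ) := by
    intro h
    have h' : (2 : ℕ) ∣ C := by exact_mod_cast h
    exact (Nat.not_even_iff_odd.mpr hCodd) (even_iff_two_dvd.mpr h')
  have h2B : (2 : ℤ) ∣ ((2 ^ α : ℕ) : ℤ) := by
    push_cast
    exact dvd_pow_self 2 (by omega)
  have hBb : 2 ∣ ((2 ^ α : ℕ) : ℤ) * y := Dvd.dvd.mul_right h2B _
  have hCz := odd_Cc_of_two_dvd_Bb hsol hBb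
  have hz : ¬ 2 ∣ z := fun h => hCz (Dvd.dvd.mul_left h _)
  obtain ⟨z', hz'sgn, hz'⟩ := exists_sign_sub_four_dvd z C hz hCoddZ
  have hsol' : IsPrimitiveSolution 1 (2 ^ α) C n x y z' := hsol.of_sign hz'sgn
  have h27 : (2 : ℤ) ^ 7 ∣ ((2 ^ α : ℕ) : ℤ) := by
    push_cast
    exact pow_dvd_pow 2 hα7
  have hv : (2 : ℤ) ^ 7 ∣ ((2 ^ α : ℕ) : ℤ) * y ^ n := Dvd.dvd.mul_right h27 _
  have hcase : FreyCase.Holds .v₇ 1 (2 ^ α) C n x y z' := ⟨hv, hz'⟩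
  have hndvd : ¬ n ∣ 1 * 2 ^ α * C := by
    intro h
    rw [one_mul] at h
    rcases (Nat.Prime.dvd_mul hn).mp h with h2 | hC
    · have := (Nat.prime_dvd_prime_iff_eq hn Nat.prime_two).mp (hn.dvd_of_dvd_pow h2)
      omega
    · exact hnC hC
  exact xno_solution_in_case M hP ⟨1, 2 ^ α, C, n, x, y, z'⟩ .v₇ (2 * C ^ 2) one_pos (by positivity) hCpos hsq hn h7
    hndvd (nthPowerFree_one_twoPow α n hαn (by omega)) hsol' h1 h2 hcase (bs04Level_one_twoPow α C n hsq hCodd hnC).1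
    hD (famBCge7 C n) ⟨rfl, ⟨α, hα7, hαn, rfl⟩, rfl, rfl⟩ hS

end Summit.Ventures.AbcSig
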